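import Literature.RingTheory.CohomologyAnnihilator.StrongGenerator
import HarnessLib

/-!
# The tower `|G|ₙ` of Iyengar–Takahashi: closure properties

Topic: `Literature/RingTheory/CohomologyAnnihilator`. Folklore closure properties of the
module-building tower `InTower G n M` ("`M ∈ |G|ₙ`") and of `IsRetractOfPower G X` ("`X ∈ add G`")
of [IyengarTakahashi2014, Definition 4.1] (vocabulary of `StrongGenerator.lean`), needed for the
Dao–Takahashi induction [IyengarTakahashi2014, Theorems 5.1, 5.2] and for the descent step of
Theorem 5.4:

* `add G`: contains `G`, zero objects, is closed under isomorphisms, retracts, finite direct sums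
  and powers (`isRetractOfPower_self`, `IsRetractOfPower.of_iso`, `.of_retract`, `.prod`, `.pi`);
* `|G|ₙ`: closed under isomorphisms (`InTower.of_iso`), monotone in `n` (`InTower.mono`),
  `|G|₁ = add G` (`inTower_one_iff`), closed under retracts (`InTower.of_retract`) and finite
  direct sums (`InTower.prod`), contains only finitely generated modules when `G` is finitely
  generated (`InTower.finite`), and the "star" inclusion `|G|_a * |G|_b ⊆ |G|_{a+b}`
  (`InTower.of_shortExact`: an extension `0 → Y → E → X → 0` with `Y ∈ |G|_a`, `X ∈ |G|_b` has
  `E ∈ |G|_{a+b}`), of which the defining clause is the case `b = 1`.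

Everything is over `ModuleCat.{u} A`, `A` a commutative ring, as in `StrongGenerator.lean`.

## References

* S. B. Iyengar, R. Takahashi, *Annihilation of cohomology and strong generation of module
  categories*, IMRN 2016; arXiv:1404.1476 — Definition 4.1, Corollary 4.6. [`IyengarTakahashi2014`]
-/

noncomputable section

open CategoryTheory CategoryTheory.Limits

universe u

namespace Literature.RingTheory.CohomologyAnnihilator

variable {A : Type u} [CommRing A]

/-! ## Bridging lemmas: short exact sequences of linear maps in `ModuleCat` -/

/-- `i ≫ p = 𝟙` elementwise. [folklore] -/
theorem retract_apply {X Z : ModuleCat.{u} A} {i : X ⟶ Z} {p : Z ⟶ X} (h : i ≫ p = 𝟙 X) (x : X) :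
    p.hom (i.hom x) = x := by
  have h' := ModuleCat.hom_ext_iff.mp h
  rw [ModuleCat.hom_comp, ModuleCat.hom_id] at h'
  simpa using LinearMap.congr_fun h' x

/-- A short exact sequence in `ModuleCat A` from an injection, a surjection and exactness of the
underlying linear maps. [folklore] -/
theorem exists_shortExact_of_linearMap {Y M X : ModuleCat.{u} A} (f : Y →ₗ[A] M) (g : M →ₗ[A] X)
    (hf : Function.Injective f) (hg : Function.Surjective g) (hfg : Function.Exact f g) :
    ∃ w : ModuleCat.ofHom f ≫ ModuleCat.ofHom g = 0,
      (ShortComplex.mk (ModuleCat.ofHom f) (ModuleCat.ofHom g) w).ShortExact := by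
  have w : ModuleCat.ofHom f ≫ ModuleCat.ofHom g = 0 := by
    ext y
    exact hfg.apply_apply_eq_zero y
  exact ⟨w, ModuleCat.shortComplex_shortExact _ hfg hf hg⟩

/-- Unpacking a short exact sequence in `ModuleCat A` into statements about functions.
[folklore] -/
theorem shortExact_unpack {Y M X : ModuleCat.{u} A} {f : Y ⟶ M} {g : M ⟶ X} {w : f ≫ g = 0}
    (h : (ShortComplex.mk f g w).ShortExact) :
    Function.Injective f ∧ Function.Surjective g ∧ Function.Exact f g :=
  ⟨h.moduleCat_injective_f, h.moduleCat_surjective_g,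
    (ShortComplex.ShortExact.moduleCat_exact_iff_function_exact _).1 h.exact⟩


/-- Replacing the middle object of a short exact sequence by an isomorphic one. [folklore] -/
theorem shortExact_comp_iso {Y M M' X : ModuleCat.{u} A} {f : Y ⟶ M} {g : M ⟶ X} {w : f ≫ g = 0}
    (hS : (ShortComplex.mk f g w).ShortExact) (ε : M ≅ M') :
    ∃ w' : (f ≫ ε.hom) ≫ (ε.inv ≫ g) = 0,
      (ShortComplex.mk (f ≫ ε.hom) (ε.inv ≫ g) w').ShortExact := by
  have w' : (f ≫ ε.hom) ≫ (ε.inv ≫ g) = 0 := by rw [Category.assoc, ε.hom_inv_id_assoc, w]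
  exact ⟨w', ShortComplex.shortExact_of_iso (S₁ := ShortComplex.mk f g w)
    (ShortComplex.isoMk (Iso.refl _) ε (Iso.refl _) (by simp) (by simp)) hS⟩

/-- If `0 → Y → M → X → 0` is short exact and `X` is a zero object then `Y ≅ M`. [folklore] -/
theorem exists_iso_of_shortExact_of_isZero {Y M X : ModuleCat.{u} A} {f : Y ⟶ M} {g : M ⟶ X}
    {w : f ≫ g = 0} (h : (ShortComplex.mk f g w).ShortExact) (hX : IsZero X) : Nonempty (Y ≅ M) := by
  obtain ⟨hf, -, hfg⟩ := shortExact_unpack h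
  have hg0 : g = 0 := hX.eq_of_tgt g 0
  have hsurj : Function.Surjective f := fun m => (hfg m).1 (by rw [hg0]; rfl)
  exact ⟨(LinearEquiv.ofBijective f.hom ⟨hf, hsurj⟩).toModuleIso⟩

/-! ## `add G` -/

/-- `G ∈ add G`. [folklore] -/
theorem isRetractOfPower_self (G : ModuleCat.{u} A) : IsRetractOfPower G G :=
  ⟨1, ModuleCat.ofHom (LinearEquiv.funUnique (Fin 1) A G).symm.toLinearMap,
    ModuleCat.ofHom (LinearEquiv.funUnique (Fin 1) A G).toLinearMap, by
      ext x
      simp⟩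

/-- A zero object is in `add G`. [folklore] -/
theorem isRetractOfPower_of_isZero (G : ModuleCat.{u} A) {X : ModuleCat.{u} A} (hX : IsZero X) :
    IsRetractOfPower G X :=
  ⟨0, 0, 0, (hX.eq_of_src _ _)⟩

/-- `add G` is closed under retracts. [folklore] -/
theorem IsRetractOfPower.of_retract {G X Z : ModuleCat.{u} A} (h : IsRetractOfPower G Z)
    (i : X ⟶ Z) (p : Z ⟶ X) (hip : i ≫ p = 𝟙 X) : IsRetractOfPower G X := by
  obtain ⟨m, i', p', h'⟩ := h
  refine ⟨m, i ≫ i', p' ≫ p, ?_⟩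
  rw [Category.assoc, reassoc_of% h', hip]

/-- `add G` is closed under isomorphisms. [folklore] -/
theorem IsRetractOfPower.of_iso {G X X' : ModuleCat.{u} A} (h : IsRetractOfPower G X)
    (e : X ≅ X') : IsRetractOfPower G X' :=
  h.of_retract e.inv e.hom e.inv_hom_id

/-- `add G` is closed under binary direct sums. [folklore] -/
theorem IsRetractOfPower.prod {G X₁ X₂ : ModuleCat.{u} A} (h₁ : IsRetractOfPower G X₁)
    (h₂ : IsRetractOfPower G X₂) : IsRetractOfPower G (ModuleCat.of A (X₁ × X₂)) := by
  obtain ⟨m₁, i₁, p₁, e₁⟩ := h₁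
  obtain ⟨m₂, i₂, p₂, e₂⟩ := h₂
  -- `Gᵐ¹ × Gᵐ² ≃ G^{m₁+m₂}`
  let ε : ((Fin m₁ → G) × (Fin m₂ → G)) ≃ₗ[A] (Fin (m₁ + m₂) → G) :=
    (LinearEquiv.sumArrowLequivProdArrow (Fin m₁) (Fin m₂) A G).symm ≪≫ₗ
      LinearEquiv.funCongrLeft A G finSumFinEquiv.symm
  refine ⟨m₁ + m₂, ModuleCat.ofHom (ε.toLinearMap ∘ₗ i₁.hom.prodMap i₂.hom),
    ModuleCat.ofHom (p₁.hom.prodMap p₂.hom ∘ₗ ε.symm.toLinearMap), ?_⟩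
  apply ModuleCat.hom_ext
  refine LinearMap.ext fun x => ?_
  simp only [ModuleCat.hom_comp, ModuleCat.hom_ofHom, LinearMap.comp_apply, LinearEquiv.coe_coe,
    LinearEquiv.symm_apply_apply, LinearMap.prodMap_apply, ModuleCat.hom_id, LinearMap.id_apply]
  exact Prod.ext (retract_apply e₁ x.1) (retract_apply e₂ x.2)

/-- `add G` is closed under finite powers. [folklore] -/
theorem IsRetractOfPower.pi {G X : ModuleCat.{u} A} (h : IsRetractOfPower G X) :
    ∀ m : ℕ, IsRetractOfPower G (ModuleCat.of A (Fin m → X))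
  | 0 => isRetractOfPower_of_isZero G (ModuleCat.isZero_of_subsingleton _)
  | m + 1 => (h.prod (h.pi m)).of_iso (Fin.consLinearEquiv A (fun _ : Fin (m + 1) => (X : Type u))).toModuleIso


/-! ## Elements of zero objects, finiteness of extensions -/

/-- Elements of a zero object of `ModuleCat A` vanish. [folklore] -/
theorem eq_zero_of_isZero {Y : ModuleCat.{u} A} (h : IsZero Y) (y : Y) : y = 0 := by
  have h' := ModuleCat.hom_ext_iff.mp (h.eq_of_src (𝟙 Y) 0)
  simpa using LinearMap.congr_fun h' y

/-- The middle term of `Y → M → X → 0` (exact at `M`, `M → X` onto) is finitely generated if `Y`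
and `X` are. [folklore] -/
theorem finite_of_exact_of_surjective {Y M X : Type*} [AddCommGroup Y] [Module A Y]
    [AddCommGroup M] [Module A M] [AddCommGroup X] [Module A X] [Module.Finite A Y]
    [Module.Finite A X] (f : Y →ₗ[A] M) (g : M →ₗ[A] X) (hfg : Function.Exact f g)
    (hg : Function.Surjective g) : Module.Finite A M := by
  refine ⟨Submodule.fg_of_fg_map_of_fg_inf_ker g ?_ ?_⟩
  · rw [Submodule.map_top, LinearMap.range_eq_top.mpr hg]
    exact Module.Finite.fg_top
  · rw [top_inf_eq, hfg.linearMap_ker_eq, LinearMap.range_eq_map]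
    exact Module.Finite.fg_top.map f

/-- Exactness of a direct sum of two exact pairs of linear maps. [folklore] -/
theorem exact_prodMap {Y₁ M₁ X₁ Y₂ M₂ X₂ : Type*} [AddCommGroup Y₁] [Module A Y₁]
    [AddCommGroup M₁] [Module A M₁] [AddCommGroup X₁] [Module A X₁] [AddCommGroup Y₂]
    [Module A Y₂] [AddCommGroup M₂] [Module A M₂] [AddCommGroup X₂] [Module A X₂]
    {f₁ : Y₁ →ₗ[A] M₁} {g₁ : M₁ →ₗ[A] X₁} {f₂ : Y₂ →ₗ[A] M₂} {g₂ : M₂ →ₗ[A] X₂}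
    (h₁ : Function.Exact f₁ g₁) (h₂ : Function.Exact f₂ g₂) :
    Function.Exact (f₁.prodMap f₂) (g₁.prodMap g₂) := by
  rintro ⟨m₁, m₂⟩
  simp only [LinearMap.prodMap_apply, Prod.mk_eq_zero, Set.mem_range, Prod.exists, Prod.mk.injEq]
  constructor
  · rintro ⟨hm₁, hm₂⟩
    obtain ⟨y₁, rfl⟩ := (h₁ m₁).1 hm₁
    obtain ⟨y₂, rfl⟩ := (h₂ m₂).1 hm₂
    exact ⟨y₁, y₂, rfl, rfl⟩
  · rintro ⟨y₁, y₂, rfl, rfl⟩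
    exact ⟨h₁.apply_apply_eq_zero y₁, h₂.apply_apply_eq_zero y₂⟩

/-- `add G` consists of finitely generated modules when `G` is finitely generated. [folklore] -/
theorem IsRetractOfPower.finite {G X : ModuleCat.{u} A} [Module.Finite A G]
    (h : IsRetractOfPower G X) : Module.Finite A X := by
  obtain ⟨m, i, p, hip⟩ := h
  exact Module.Finite.of_surjective p.hom fun x => ⟨i.hom x, retract_apply hip x⟩

/-! ## `|G|ₙ`: isomorphisms, monotonicity, `|G|₁ = add G` -/

/-- `|G|ₙ` is closed under isomorphisms. [folklore] -/
theorem InTower.of_iso {G : ModuleCat.{u} A} :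
    ∀ {n : ℕ} {M M' : ModuleCat.{u} A}, InTower G n M → (M ≅ M') → InTower G n M'
  | 0, _, _, h, e => IsZero.of_iso h e.symm
  | n + 1, M, M', ⟨W, Y, X, hY, hX, f, g, w, hS⟩, e => by
    let ε : ModuleCat.of A (M × W) ≅ ModuleCat.of A (M' × W) :=
      (e.toLinearEquiv.prodCongr (LinearEquiv.refl A W)).toModuleIso
    obtain ⟨w', hS'⟩ := shortExact_comp_iso hS ε
    exact ⟨W, Y, X, hY, hX, f ≫ ε.hom, ε.inv ≫ g, w', hS'⟩

/-- The defining clause of `|G|ₙ₊₁` with no auxiliary summand: an extension `0 → Y → M → X → 0`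
with `Y ∈ |G|ₙ` and `X ∈ add G` has `M ∈ |G|ₙ₊₁`. [cite: IyengarTakahashi2014, Def. 4.1] -/
theorem inTower_succ_of_shortExact {G : ModuleCat.{u} A} {n : ℕ} {Y M X : ModuleCat.{u} A}
    (hY : InTower G n Y) (hX : IsRetractOfPower G X) {f : Y ⟶ M} {g : M ⟶ X} {w : f ≫ g = 0}
    (hS : (ShortComplex.mk f g w).ShortExact) : InTower G (n + 1) M := by
  let ε : M ≅ ModuleCat.of A (M × PUnit.{u + 1}) :=
    (LinearEquiv.prodUnique (R := A) (M := M) (M₂ := PUnit.{u + 1})).symm.toModuleIso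
  obtain ⟨w', hS'⟩ := shortExact_comp_iso hS ε
  exact ⟨ModuleCat.of A PUnit.{u + 1}, Y, X, hY, hX, f ≫ ε.hom, ε.inv ≫ g, w', hS'⟩

/-- `|G|ₙ ⊆ |G|ₙ₊₁`. [folklore] -/
theorem InTower.succ {G : ModuleCat.{u} A} {n : ℕ} {M : ModuleCat.{u} A} (h : InTower G n M) :
    InTower G (n + 1) M := by
  obtain ⟨w, hS⟩ := exists_shortExact_of_linearMap (Y := M) (M := M)
    (X := ModuleCat.of A PUnit.{u + 1}) LinearMap.id 0 Function.injective_id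
    (fun x => ⟨0, Subsingleton.elim _ _⟩) (fun x => by simp)
  exact inTower_succ_of_shortExact h
    (isRetractOfPower_of_isZero G (ModuleCat.isZero_of_subsingleton _)) hS

/-- `|G|ₘ ⊆ |G|ₙ` for `m ≤ n`. [folklore] -/
theorem InTower.mono {G : ModuleCat.{u} A} {m n : ℕ} (hmn : m ≤ n) {M : ModuleCat.{u} A}
    (h : InTower G m M) : InTower G n M := by
  induction hmn with
  | refl => exact h
  | step _ ih => exact ih.succ

/-- Zero objects lie in every `|G|ₙ`. [folklore] -/
theorem InTower.of_isZero (G : ModuleCat.{u} A) (n : ℕ) {M : ModuleCat.{u} A} (hM : IsZero M) :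
    InTower G n M :=
  InTower.mono (Nat.zero_le n) (show InTower G 0 M from hM)

/-- `add G ⊆ |G|₁`. [cite: IyengarTakahashi2014, Def. 4.1] -/
theorem InTower.of_isRetractOfPower {G X : ModuleCat.{u} A} (h : IsRetractOfPower G X) :
    InTower G 1 X := by
  obtain ⟨w, hS⟩ := exists_shortExact_of_linearMap (Y := ModuleCat.of A PUnit.{u + 1}) (M := X)
    (X := X) 0 LinearMap.id (fun a b _ => Subsingleton.elim a b) Function.surjective_id
    ((LinearMap.exact_zero_iff_injective _ LinearMap.id).mpr Function.injective_id)
  exact inTower_succ_of_shortExact (show InTower G 0 (ModuleCat.of A PUnit.{u + 1}) from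
    ModuleCat.isZero_of_subsingleton _) h hS

/-- `|G|₁ ⊆ add G`. [cite: IyengarTakahashi2014, Def. 4.1] -/
theorem isRetractOfPower_of_inTower_one {G M : ModuleCat.{u} A} (h : InTower G 1 M) :
    IsRetractOfPower G M := by
  obtain ⟨W, Y, X, hY, hX, f, g, w, hS⟩ := h
  obtain ⟨-, hg, hfg⟩ := shortExact_unpack hS
  have hinj : Function.Injective g := by
    intro a b hab
    have hab' : g (a - b) = 0 := by rw [map_sub, hab, sub_self]
    obtain ⟨y, hy⟩ := (hfg _).1 hab'
    rw [eq_zero_of_isZero hY y, map_zero] at hy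
    exact sub_eq_zero.mp hy.symm
  let e : ModuleCat.of A (M × W) ≅ X := (LinearEquiv.ofBijective g.hom ⟨hinj, hg⟩).toModuleIso
  refine (hX.of_iso e.symm).of_retract (ModuleCat.ofHom (LinearMap.inl A M W))
    (ModuleCat.ofHom (LinearMap.fst A M W)) ?_
  apply ModuleCat.hom_ext
  exact LinearMap.ext fun x => rfl

/-- `|G|₁ = add G`. [cite: IyengarTakahashi2014, Def. 4.1] -/
theorem inTower_one_iff {G M : ModuleCat.{u} A} : InTower G 1 M ↔ IsRetractOfPower G M :=
  ⟨isRetractOfPower_of_inTower_one, InTower.of_isRetractOfPower⟩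

/-! ## Retracts -/

/-- A retract `X` of `Z` (`i ≫ p = 𝟙 X`) splits off: `Z ≅ X × Ker p`. [folklore] -/
theorem exists_iso_prod_of_retract {X Z : ModuleCat.{u} A} (i : X ⟶ Z) (p : Z ⟶ X)
    (h : i ≫ p = 𝟙 X) : Nonempty (Z ≅ ModuleCat.of A (X × LinearMap.ker p.hom)) := by
  have hpi : ∀ x, p.hom (i.hom x) = x := retract_apply h
  let q : Z →ₗ[A] LinearMap.ker p.hom :=
    LinearMap.codRestrict (LinearMap.ker p.hom) (LinearMap.id - i.hom ∘ₗ p.hom) fun z => by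
      simp [hpi]
  refine ⟨LinearEquiv.toModuleIso (LinearEquiv.ofLinear (p.hom.prod q)
    (i.hom.coprod (LinearMap.ker p.hom).subtype) ?_ ?_)⟩
  · refine LinearMap.ext fun x => Prod.ext ?_ (Subtype.ext ?_)
    · obtain ⟨x, k, hk⟩ := x
      simp [hpi, (LinearMap.mem_ker.mp hk)]
    · obtain ⟨x, k, hk⟩ := x
      simp [q, hpi, (LinearMap.mem_ker.mp hk)]
  · refine LinearMap.ext fun z => ?_
    simp [q]

/-- `|G|ₙ` is closed under retracts (direct summands). [cite: IyengarTakahashi2014, Def. 4.1] -/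
theorem InTower.of_retract {G : ModuleCat.{u} A} :
    ∀ {n : ℕ} {X Z : ModuleCat.{u} A}, InTower G n Z → ∀ (i : X ⟶ Z) (p : Z ⟶ X),
      i ≫ p = 𝟙 X → InTower G n X
  | 0, X, _, hZ, i, p, h =>
    (IsZero.iff_id_eq_zero X).mpr (by rw [← h, hZ.eq_of_tgt i 0, zero_comp])
  | n + 1, X, Z, ⟨W, Y, X₀, hY, hX₀, f, g, w, hS⟩, i, p, h => by
    obtain ⟨e⟩ := exists_iso_prod_of_retract i p h
    let ε : ModuleCat.of A (Z × W) ≅ ModuleCat.of A (X × (LinearMap.ker p.hom × W)) :=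
      (e.toLinearEquiv.prodCongr (LinearEquiv.refl A W) ≪≫ₗ
        LinearEquiv.prodAssoc A X (LinearMap.ker p.hom) W).toModuleIso
    obtain ⟨w', hS'⟩ := shortExact_comp_iso hS ε
    exact ⟨ModuleCat.of A (LinearMap.ker p.hom × W), Y, X₀, hY, hX₀, f ≫ ε.hom, ε.inv ≫ g, w', hS'⟩

/-! ## Direct sums and finiteness -/

/-- `|G|ₙ` is closed under binary direct sums. [folklore] -/
theorem InTower.prod {G : ModuleCat.{u} A} :
    ∀ {n : ℕ} {M₁ M₂ : ModuleCat.{u} A}, InTower G n M₁ → InTower G n M₂ →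
      InTower G n (ModuleCat.of A (M₁ × M₂))
  | 0, M₁, M₂, h₁, h₂ => by
    haveI : Subsingleton M₁ := ⟨fun a b => by rw [eq_zero_of_isZero h₁ a, eq_zero_of_isZero h₁ b]⟩
    haveI : Subsingleton M₂ := ⟨fun a b => by rw [eq_zero_of_isZero h₂ a, eq_zero_of_isZero h₂ b]⟩
    exact ModuleCat.isZero_of_subsingleton _
  | n + 1, M₁, M₂, ⟨W₁, Y₁, X₁, hY₁, hX₁, f₁, g₁, w₁, hS₁⟩, ⟨W₂, Y₂, X₂, hY₂, hX₂, f₂, g₂, w₂, hS₂⟩ => by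
    obtain ⟨hf₁, hg₁, hfg₁⟩ := shortExact_unpack hS₁
    obtain ⟨hf₂, hg₂, hfg₂⟩ := shortExact_unpack hS₂
    let ε : ((M₁ × W₁) × (M₂ × W₂)) ≃ₗ[A] ((M₁ × M₂) × (W₁ × W₂)) :=
      LinearEquiv.prodProdProdComm A M₁ W₁ M₂ W₂
    obtain ⟨w, hS⟩ := exists_shortExact_of_linearMap (Y := ModuleCat.of A (Y₁ × Y₂))
      (M := ModuleCat.of A ((M₁ × M₂) × (W₁ × W₂))) (X := ModuleCat.of A (X₁ × X₂))
      (ε.toLinearMap ∘ₗ f₁.hom.prodMap f₂.hom) ((g₁.hom.prodMap g₂.hom) ∘ₗ ε.symm.toLinearMap)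
      (ε.injective.comp (hf₁.prodMap hf₂)) ((hg₁.prodMap hg₂).comp ε.symm.surjective)
      ((LinearEquiv.conj_exact_iff_exact _ _ ε).mpr (exact_prodMap hfg₁ hfg₂))
    exact ⟨ModuleCat.of A (W₁ × W₂), ModuleCat.of A (Y₁ × Y₂), ModuleCat.of A (X₁ × X₂),
      InTower.prod hY₁ hY₂, hX₁.prod hX₂, _, _, w, hS⟩

/-- Members of `|G|ₙ` are finitely generated when `G` is. [folklore] -/
theorem InTower.finite {G : ModuleCat.{u} A} [Module.Finite A G] :
    ∀ {n : ℕ} {M : ModuleCat.{u} A}, InTower G n M → Module.Finite A M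
  | 0, _, h => Module.Finite.of_surjective (0 : A →ₗ[A] _) fun x =>
      ⟨0, by rw [eq_zero_of_isZero h x, map_zero]⟩
  | n + 1, M, ⟨W, Y, X, hY, hX, f, g, w, hS⟩ => by
    haveI := InTower.finite hY
    haveI := hX.finite
    obtain ⟨-, hg, hfg⟩ := shortExact_unpack hS
    haveI : Module.Finite A (M × W) := finite_of_exact_of_surjective f.hom g.hom hfg hg
    exact Module.Finite.of_surjective (LinearMap.fst A M W) Prod.fst_surjective

/-- In `|G|ₙ` with `n ≥ 1` one may add a summand from `add G`. [folklore] -/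
theorem InTower.prod_of_isRetractOfPower {G : ModuleCat.{u} A} {n : ℕ} (hn : 1 ≤ n)
    {M X : ModuleCat.{u} A} (hM : InTower G n M) (hX : IsRetractOfPower G X) :
    InTower G n (ModuleCat.of A (M × X)) :=
  hM.prod (InTower.mono hn (InTower.of_isRetractOfPower hX))

/-! ## The star inclusion `|G|_a * |G|_b ⊆ |G|_{a+b}` -/

/-- **`|G|_a * |G|_b ⊆ |G|_{a+b}`**: an extension `0 → Y → E → X → 0` with `Y ∈ |G|_a` and
`X ∈ |G|_b` has `E ∈ |G|_{a+b}` (induction on `b`: pull the top clause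
`0 → Y' → X ⊕ W → X₀ → 0` of `X` back along `E ⊕ W ↠ X ⊕ W`).
[cite: IyengarTakahashi2014, Def. 4.1, Cor. 4.6] -/
theorem InTower.of_shortExact {G : ModuleCat.{u} A} {a : ℕ} :
    ∀ {b : ℕ} {Y E X : ModuleCat.{u} A}, InTower G a Y → InTower G b X →
      ∀ {f : Y ⟶ E} {g : E ⟶ X} {w : f ≫ g = 0}, (ShortComplex.mk f g w).ShortExact →
        InTower G (a + b) E
  | 0, Y, E, X, hY, hX, f, g, w, hS => by
    obtain ⟨e⟩ := exists_iso_of_shortExact_of_isZero hS hX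
    exact hY.of_iso e
  | b + 1, Y, E, X, hY, ⟨W, Y', X₀, hY', hX₀, f', g', w', hS'⟩, f, g, w, hS => by
    obtain ⟨hf, hg, hfg⟩ := shortExact_unpack hS
    obtain ⟨hf', hg', hfg'⟩ := shortExact_unpack hS'
    -- `ψ = g ⊕ 1 : E ⊕ W ↠ X ⊕ W`, `φ = g' ∘ ψ : E ⊕ W ↠ X₀`, `E' = Ker φ`
    let ψ : (E × W) →ₗ[A] (X × W) := g.hom.prodMap LinearMap.id
    have hψ : Function.Surjective ψ := hg.prodMap Function.surjective_id
    let φ : (E × W) →ₗ[A] X₀ := g'.hom ∘ₗ ψ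
    have hφ : Function.Surjective φ := hg'.comp hψ
    let E' := LinearMap.ker φ
    have hmem : ∀ x : E', ψ x.1 ∈ LinearMap.range f'.hom := fun x =>
      LinearMap.mem_range.mpr ((hfg' _).1 x.2)
    -- `0 → Y → E' → Y' → 0`
    let ι : Y →ₗ[A] E' := LinearMap.codRestrict E' (LinearMap.inl A E W ∘ₗ f.hom) fun y => by
      show g'.hom (ψ (f.hom y, 0)) = 0
      simp [ψ, hfg.apply_apply_eq_zero, Prod.mk_zero_zero]
    let eR := LinearEquiv.ofInjective f'.hom hf'
    let τ : E' →ₗ[A] Y' := eR.symm.toLinearMap ∘ₗ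
      LinearMap.codRestrict (LinearMap.range f'.hom) (ψ ∘ₗ E'.subtype) hmem
    have hτ : ∀ x : E', f'.hom (τ x) = ψ x.1 := fun x => by
      have h := congrArg Subtype.val (eR.apply_symm_apply ⟨ψ x.1, hmem x⟩)
      rw [LinearEquiv.ofInjective_apply] at h
      exact h
    have hι_inj : Function.Injective ι := by
      intro y₁ y₂ hy
      have := congrArg (fun x : E' => x.1.1) hy
      exact hf (by simpa [ι] using this)
    have hτ_surj : Function.Surjective τ := by
      intro y'
      obtain ⟨e, he⟩ := hg (f'.hom y').1
      have hx : (e, (f'.hom y').2) ∈ E' := by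
        show g'.hom (ψ (e, (f'.hom y').2)) = 0
        have : ψ (e, (f'.hom y').2) = f'.hom y' := Prod.ext he rfl
        rw [this]
        exact hfg'.apply_apply_eq_zero y'
      refine ⟨⟨_, hx⟩, hf' ?_⟩
      rw [hτ]
      exact Prod.ext he rfl
    have hιτ : Function.Exact ι τ := by
      intro x
      constructor
      · intro hx0
        have h1 : ψ x.1 = 0 := by rw [← hτ, hx0, map_zero]
        have h2 : g.hom x.1.1 = 0 ∧ x.1.2 = 0 := by
          simpa [ψ, Prod.ext_iff] using h1
        obtain ⟨y, hy⟩ := (hfg _).1 h2.1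
        refine ⟨y, Subtype.ext (Prod.ext ?_ ?_)⟩
        · simpa [ι] using hy
        · simp [ι, h2.2]
      · rintro ⟨y, rfl⟩
        apply hf'
        rw [hτ, map_zero]
        show ψ (f.hom y, 0) = 0
        simp [ψ, hfg.apply_apply_eq_zero, Prod.mk_zero_zero]
    obtain ⟨w₁, hS₁⟩ := exists_shortExact_of_linearMap (Y := Y) (M := ModuleCat.of A E')
      (X := Y') ι τ hι_inj hτ_surj hιτ
    have hE' : InTower G (a + b) (ModuleCat.of A E') := InTower.of_shortExact hY hY' hS₁
    -- `0 → E' → E ⊕ W → X₀ → 0`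
    obtain ⟨w₂, hS₂⟩ := exists_shortExact_of_linearMap (Y := ModuleCat.of A E')
      (M := ModuleCat.of A (E × W)) (X := X₀) E'.subtype φ Subtype.val_injective hφ
      (LinearMap.exact_subtype_ker_map φ)
    exact ⟨W, ModuleCat.of A E', X₀, hE', hX₀, _, _, w₂, hS₂⟩

end Literature.RingTheory.CohomologyAnnihilator

end
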